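import Literature.AlgebraicGeometry.Resolution.PermissibleBlowup
import Literature.AlgebraicGeometry.Resolution.OrderSemicontinuity
import HarnessLib

/-!
# Principalization from embedded resolution of idealistic exponents (CoP1: Prop. 4.2 ⇐ Prop. 4.4)

Topic: `Literature/AlgebraicGeometry/Resolution`. [CoP1] = Cossart–Piltant, J. Algebra 320
(2008), proof of Prop. 4.2 (Principalisation), pp. 7–8, reduces principalization of an ideal
sheaf `I` on a regular threefold `X` to Prop. 4.4 (desingularization of idealistic exponents
`E = (J, μ)` with `dim V(J) ≤ 1` by blowing ups with permissible centres):

> "Let `E_1, …, E_m` be the irreducible components of codimension one of `Z := V(I)_red`, and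
> `a(j) := ord_{E_j} I` … `H := 𝒪_X(-∑ a(i)E_i) ⊆ I`, and `J := H⁻¹ I ⊆ 𝒪_X` is such that `V(J)`
> has codimension at least two in `X`. … `μ := sup_{x ∈ X} {m(x)}`, `Σ := {x ∈ X | m(x) = μ}`.
> Clearly `I` is locally principal ⇔ `μ = 0` ⇔ `J = 𝒪_X`. … A closed set `Y` is called
> permissible at `x ∈ Σ` if `Y` is regular at `x` and `Y ⊆ Σ` … `E′ = (J′, μ)` where
> `J′ = I(Y)^{-μ} J` is the weak transform of `J`. … Using induction on `μ`, proposition 4.2 is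
> now a consequence of its rephrased version in proposition 4.4 below."

and Cossart–Piltant 2019, Prop. 4.4 (arXiv v1: Prop. 4.3) is this principalization for regular
excellent threefolds (`CossartPiltant2019Principalization`, `Principalization.lean`). This file
PROVES the reduction, with Prop. 4.4 entering as an explicit hypothesis:

* `IsPermissibleSeq π J μ J'` (inductive) — `π : X' → X` is a finite composition of blowing ups
  along regular integral centres `Y ⊆ Σ = {x | ord_x = μ}` of the successive weak transforms,
  and `J'` is the resulting weak transform of `J` (the "transform `E(n)` of `E` in `X(n)`" of
  Prop. 4.4, for centres permissible in the sense of loc. cit.);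
* `IsPermissibleSeq.transport` — along such a sequence starting from a stage `ρ : X → S` of a
  Cossart–Piltant sequence for `I` (`IsRegularCentreBlowupSeq ρ I`) with `I𝒪_X = H · J`, `H`
  invertible and `V(J)` of codimension `≥ 2`: the composite is again such a stage, and
  `I𝒪_{X'} = H' · J'` with `H'` invertible and `V(J')` of codimension `≥ 2`
  (`PermissibleBlowup.lean`);
* `exists_principalization_of_prop44` — **Prop. 4.2 ⇐ Prop. 4.4**: if every idealistic exponent
  `(J, μ)`, `μ ≥ 1` the maximal order of `J`, `V(J)` of codimension `≥ 2`, on every stage of a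
  Cossart–Piltant sequence for `I` over `S` is desingularized by a permissible sequence
  (`∀ x, ord_x J' < μ`), then `I` is principalized by a Cossart–Piltant sequence — induction on
  `μ`, started by the divisorial decomposition (`DivisorialPart.lean`) and the boundedness of the
  order on the regular excellent `S` (`OrderSemicontinuity.lean`);
* `cossartPiltant2019Principalization_of_prop44` — the same with the quantifiers of
  `CossartPiltant2019Principalization`.

## Faithfulness notes

* Prop. 4.4 is rendered for the stages `X → S` of Cossart–Piltant sequences over the given
  regular excellent threefold `S` (these are the `X(i)` to which the printed induction applies
  it; they are again regular excellent threefolds by EGA IV 7.8.3 and Liu Thm. 8.1.19), with the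
  hypotheses "`μ = max ord`" (`∀ x, ord_x J ≤ μ`, attained) made explicit and "`dim V(J) ≤ 1`"
  in the form used by the proof, "`V(J)` has codimension at least two"; its conclusion
  "`Σ(n) = ∅`" is `∀ x, ord_x J(n) < μ`.
* No dimension hypothesis on `S` is needed for the reduction itself.

## Sources

* V. Cossart, O. Piltant, J. Algebra 320 (2008) 1051–1082, Prop. 4.2, proof (pp. 7–8), and
  Prop. 4.4. [CossartPiltant2008]
* V. Cossart, O. Piltant, J. Algebra 529 (2019), Prop. 4.4 (arXiv:1412.0868 v1: Prop. 4.3).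
  [CossartPiltant2019]
-/

noncomputable section

open CategoryTheory CategoryTheory.Limits AlgebraicGeometry TopologicalSpace IsLocalRing

namespace Literature.AlgebraicGeometry.Resolution

universe u

open Scheme.IdealSheafData

/-! ## Permissible sequences of blowing ups and the weak transform -/

/-- **Permissible sequences for the idealistic exponent `(J, μ)`** ([CoP1], proof of Prop. 4.2
and Prop. 4.4): `IsPermissibleSeq π J μ J'` says that `π : X' → X` is a finite composition of
blowing ups, each along a regular integral closed subscheme `Y` contained in the locus
`Σ = {x | ord_x = μ}` of the current weak transform ("`Y` is called permissible at `x ∈ Σ` if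
`Y` is regular at `x` and `Y ⊆ Σ`"), and that `J'` is the weak transform of `J` on `X'`
("`E′ = (J′, μ)` where `J′ = I(Y)^{-μ} J`", iterated; `controlledTransform` of
`MarkedIdeals.lean`). [cite: CossartPiltant2008, proof of Prop. 4.2] -/
inductive IsPermissibleSeq :
    ∀ {X' X : Scheme.{u}}, (X' ⟶ X) → X.IdealSheafData → ℕ → X'.IdealSheafData → Prop
  /-- the empty sequence -/
  | nil {X : Scheme.{u}} (J : X.IdealSheafData) (μ : ℕ) : IsPermissibleSeq (𝟙 X) J μ J
  /-- one more blowing up along a regular integral centre inside `{ord = μ}` -/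
  | cons {X'' X' X : Scheme.{u}} (τ : X'' ⟶ X') (π : X' ⟶ X) (J : X.IdealSheafData) (μ : ℕ)
      (J' : X'.IdealSheafData) (Y : Closeds X') :
      IsPermissibleSeq π J μ J' →
      IsIntegral (vanishingIdeal Y).subscheme →
      Scheme.IsRegular (vanishingIdeal Y).subscheme →
      (∀ y ∈ (Y : Set X'), idealOrder J' y = μ) →
      IsBlowup τ (vanishingIdeal Y) →
      IsPermissibleSeq (τ ≫ π) J μ (controlledTransform τ (vanishingIdeal Y) J' μ)

/-- A single permissible blowing up is a permissible sequence. [folklore] -/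
theorem IsPermissibleSeq.single {X' X : Scheme.{u}} (τ : X' ⟶ X) (J : X.IdealSheafData) (μ : ℕ)
    (Y : Closeds X) (hint : IsIntegral (vanishingIdeal Y).subscheme)
    (hreg : Scheme.IsRegular (vanishingIdeal Y).subscheme)
    (hY : ∀ y ∈ (Y : Set X), idealOrder J y = μ) (hτ : IsBlowup τ (vanishingIdeal Y)) :
    IsPermissibleSeq τ J μ (controlledTransform τ (vanishingIdeal Y) J μ) := by
  have := IsPermissibleSeq.cons τ (𝟙 X) J μ J Y (IsPermissibleSeq.nil J μ) hint hreg hY hτ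
  rwa [Category.comp_id] at this

/-- An ideal sheaf whose support has no point of codimension `≤ 1` is non-zero (the generic
point has codimension `0`). [folklore] -/
theorem ne_bot_of_forall_one_lt_coheight {X : Scheme.{u}} [IsIntegral X] {J : X.IdealSheafData}
    (hJ : ∀ x ∈ J.support, 1 < Order.coheight x) : J ≠ ⊥ := by
  intro h
  have hmem : (⊤ : X) ∈ J.support := by
    rw [h, Scheme.IdealSheafData.support_bot]
    trivial
  have := hJ _ hmem
  rw [Order.coheight_top] at this
  exact not_lt_bot this

/-! ## Transport of the divisorial bookkeeping along a permissible sequence -/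

/-- **Along a permissible sequence the bookkeeping of [CoP1], proof of Prop. 4.2, persists.**
Let `S` be regular, integral and Noetherian, `I` an ideal sheaf on `S`, `ρ : X → S` a stage of a
Cossart–Piltant sequence for `I` (`IsRegularCentreBlowupSeq ρ I`) with `X` integral Noetherian,
`I𝒪_X = H · J` with `H` an effective Cartier divisor and `V(J)` of codimension `≥ 2`, and
`π : X' → X` a permissible sequence for `(J, μ)`, `μ ≥ 1`, with weak transform `J'`. Then `X'`
is integral and Noetherian, `π ≫ ρ` is again a Cossart–Piltant sequence for `I` (the centres
lie in the non-locally-principal locus of `I𝒪`), and `I𝒪_{X'} = H' · J'` with `H'` effective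
Cartier (`H' = H𝒪_{X'} · 𝓘_E^μ` at each step) and `V(J')` of codimension `≥ 2`.
[cite: CossartPiltant2008, proof of Prop. 4.2] -/
theorem IsPermissibleSeq.transport {S : Scheme.{u}} [IsIntegral S] [IsNoetherian S]
    (hS : Scheme.IsRegular S) (I : S.IdealSheafData) :
    ∀ {X' X : Scheme.{u}} {π : X' ⟶ X} {J : X.IdealSheafData} {μ : ℕ} {J' : X'.IdealSheafData},
      IsPermissibleSeq π J μ J' → 1 ≤ μ →
      ∀ (ρ : X ⟶ S) (H : X.IdealSheafData), IsIntegral X → IsNoetherian X →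
        IsRegularCentreBlowupSeq ρ I → IsEffectiveCartier H → I.comap ρ = H * J →
        (∀ x ∈ J.support, 1 < Order.coheight x) →
        IsIntegral X' ∧ IsNoetherian X' ∧ IsRegularCentreBlowupSeq (π ≫ ρ) I ∧
          ∃ H' : X'.IdealSheafData, IsEffectiveCartier H' ∧ I.comap (π ≫ ρ) = H' * J' ∧
            ∀ x ∈ J'.support, 1 < Order.coheight x := by
  intro X' X π J μ J' h
  induction h with
  | nil J μ =>
    intro _ ρ H hint hnoeth hρ hH hfac hJ
    exact ⟨hint, hnoeth, by rwa [Category.id_comp], H, hH, by rwa [Category.id_comp], hJ⟩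
  | @cons X'' X' X τ π J μ J' Y hπ hYint hYreg hY hτ ih =>
    intro hμ ρ H hint hnoeth hρ hH hfac hJ
    obtain ⟨hint', hnoeth', hρ', H', hH', hfac', hJ'⟩ := ih hμ ρ H hint hnoeth hρ hH hfac hJ
    haveI := hint'
    haveI := hnoeth'
    have hreg' := hρ'.isRegular hS
    have hJ'0 : J' ≠ ⊥ := ne_bot_of_forall_one_lt_coheight hJ'
    -- the new scheme is integral and Noetherian
    haveI : IsIntegral X'' :=
      hτ.isIntegral (vanishingIdeal_ne_bot_of_forall_idealOrder_eq hJ'0 hμ hY)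
    haveI : IsNoetherian X'' := by
      haveI : IsProper τ := hτ.isProper
      haveI := LocallyOfFiniteType.isLocallyNoetherian τ
      haveI := QuasiCompact.compactSpace_of_compactSpace τ
      exact {}
    refine ⟨inferInstance, inferInstance, ?_, H'.comap τ * (vanishingIdeal Y).comap τ ^ μ,
      (hH'.comap_of_isBlowup hτ).mul (hτ.isEffectiveCartier.pow μ), ?_, fun x hx =>
      hτ.one_lt_coheight_of_mem_support_controlledTransform hreg' hYreg hY hJ' hx⟩
    · -- the centre lies in the non-locally-principal locus of `I𝒪 = H' · J'`
      rw [Category.assoc]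
      refine IsRegularCentreBlowupSeq.cons τ (π ≫ ρ) I Y hρ' hYint hYreg (fun y hy => ?_) hτ
      rw [hfac']
      refine not_isLocallyPrincipalAt_mul_of_forall_one_lt_coheight hH' hJ'0 hJ' ?_
      refine (one_le_idealOrder_iff J' y).mp ?_
      rw [hY y hy]
      exact_mod_cast hμ
    · -- `I𝒪_{X''} = (H'𝒪 · 𝓘_E^μ) · J''`
      rw [Category.assoc, Scheme.IdealSheafData.comap_comp, hfac', comap_mul,
        ← hτ.pow_mul_controlledTransform_eq_of_forall_idealOrder_eq hreg' hYreg hY, mul_assoc]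

/-! ## Prop. 4.2 from Prop. 4.4 -/

/-- **[CoP1], Prop. 4.2 ⇐ Prop. 4.4 ("Using induction on `μ`, proposition 4.2 is now a
consequence of its rephrased version in proposition 4.4").** Let `S` be a regular, excellent,
integral Noetherian scheme and `I ≠ 0` an ideal sheaf on `S`. Suppose Prop. 4.4 on the stages
of Cossart–Piltant sequences for `I` over `S`: for every such stage `ρ : X → S` (`X` integral
Noetherian) and every idealistic exponent `(J, μ)` on `X` with `μ ≥ 1` the maximal order of `J`
(`ord_x J ≤ μ` everywhere, with equality somewhere) and `V(J)` of codimension `≥ 2` (so of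
dimension `≤ 1` in a threefold), there is a permissible sequence `π : X' → X` whose weak
transform `J'` has `ord_x J' < μ` everywhere ("`Σ(n) = ∅`"). Then there is a Cossart–Piltant
sequence `σ : S' → S` (blowing ups along regular integral centres in the non-locally-principal
loci) with `I𝒪_{S'}` locally principal. Proof as printed: write `I = H · J` (divisorial
decomposition, `DivisorialPart.lean`), bound the order of `J` (`OrderSemicontinuity.lean`), and
induct on the bound: if `ord J ≤ 0` everywhere then `J = 𝒪` and `I𝒪 = H` is invertible;
otherwise Prop. 4.4 lowers the maximal order, the bookkeeping being
`IsPermissibleSeq.transport`. [cite: CossartPiltant2008, Prop. 4.2 (proof)] -/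
theorem exists_principalization_of_prop44 (S : Scheme.{u}) [IsIntegral S] [IsNoetherian S]
    (hreg : Scheme.IsRegular S) (hexc : Scheme.IsExcellent S) (I : S.IdealSheafData) (hI : I ≠ ⊥)
    (h44 : ∀ (X : Scheme.{u}) (ρ : X ⟶ S) [IsIntegral X] [IsNoetherian X],
      IsRegularCentreBlowupSeq ρ I → ∀ (J : X.IdealSheafData) (μ : ℕ), 1 ≤ μ →
        (∀ x ∈ J.support, 1 < Order.coheight x) → (∀ x, idealOrder J x ≤ μ) →
        (∃ x, idealOrder J x = μ) →
        ∃ (X' : Scheme.{u}) (π : X' ⟶ X) (J' : X'.IdealSheafData),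
          IsPermissibleSeq π J μ J' ∧ ∀ x, idealOrder J' x < μ) :
    ∃ (S' : Scheme.{u}) (σ : S' ⟶ S), IsRegularCentreBlowupSeq σ I ∧
      IsLocallyPrincipal (I.comap σ) := by
  -- the claim, by induction on a bound `m` for the order of `J`
  have claim : ∀ (m : ℕ) (X : Scheme.{u}) (ρ : X ⟶ S) (H J : X.IdealSheafData)
      [IsIntegral X] [IsNoetherian X], IsRegularCentreBlowupSeq ρ I → IsEffectiveCartier H →
      I.comap ρ = H * J → (∀ x ∈ J.support, 1 < Order.coheight x) →
      (∀ x, idealOrder J x ≤ m) →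
      ∃ (S' : Scheme.{u}) (σ : S' ⟶ S), IsRegularCentreBlowupSeq σ I ∧
        IsLocallyPrincipal (I.comap σ) := by
    intro m
    induction m with
    | zero =>
      intro X ρ H J _ _ hρ hH hfac hJ hbd
      -- `ord J ≤ 0` everywhere: `J = 𝒪_X` and `I𝒪_X = H` is invertible
      have hJtop : J = ⊤ := by
        rw [← support_eq_bot_iff, eq_bot_iff]
        intro x hx
        have h1 := (one_le_idealOrder_iff J x).mpr hx
        have h2 := h1.trans (hbd x)
        norm_num at h2
      refine ⟨X, ρ, hρ, ?_⟩
      rw [hfac, hJtop, ← Scheme.IdealSheafData.one_eq_top, mul_one]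
      exact hH.isLocallyPrincipal
    | succ m ih =>
      intro X ρ H J _ _ hρ hH hfac hJ hbd
      by_cases hall : ∀ x, idealOrder J x ≤ m
      · exact ih X ρ H J hρ hH hfac hJ hall
      push Not at hall
      obtain ⟨x₀, hx₀⟩ := hall
      have hx₀' : idealOrder J x₀ = (m + 1 : ℕ) := by
        refine le_antisymm (hbd x₀) ?_
        have := Order.add_one_le_of_lt hx₀
        exact_mod_cast this
      -- Prop. 4.4 for `(J, m + 1)` on the stage `X`
      obtain ⟨X', π, J', hπ, hJ'⟩ := h44 X ρ hρ J (m + 1) m.succ_pos hJ hbd ⟨x₀, hx₀'⟩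
      obtain ⟨hint', hnoeth', hρ', H', hH', hfac', hJ'coh⟩ :=
        hπ.transport hreg I m.succ_pos ρ H inferInstance inferInstance hρ hH hfac hJ
      haveI := hint'
      haveI := hnoeth'
      refine ih X' (π ≫ ρ) H' J' hρ' hH' hfac' hJ'coh fun x => ?_
      have := hJ' x
      push_cast at this
      exact Order.le_of_lt_add_one this
  -- start: `I = H · J` on `S` and a bound for the order of `J`
  obtain ⟨H, J, hH, hHJ, -, -, hJcoh⟩ := exists_divisorial_decomposition hreg hI
  have hJ0 : J ≠ ⊥ := ne_bot_of_forall_one_lt_coheight hJcoh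
  obtain ⟨N, hN⟩ := exists_forall_idealOrder_lt hreg hexc hJ0
  exact claim N S (𝟙 S) H J (IsRegularCentreBlowupSeq.nil I) hH
    (by rw [Scheme.IdealSheafData.comap_id, hHJ]) hJcoh fun x => (hN x).le

/-- **Cossart–Piltant 2019, Prop. 4.4 (arXiv v1: Prop. 4.3) from [CoP1] Prop. 4.4**: the named
fact `CossartPiltant2019Principalization` follows from embedded resolution of idealistic
exponents `(J, μ)` with `V(J)` of codimension `≥ 2` on the stages of Cossart–Piltant sequences
over regular excellent threefolds (the statement proved in [CoP1] Prop. 4.4 via Lemma 4.3,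
Lemma 4.5, made characteristic free by [CoP3] Thm. II.3).
[cite: CossartPiltant2019, Prop. 4.4 (arXiv v1: Prop. 4.3)] -/
theorem cossartPiltant2019Principalization_of_prop44
    (h44 : ∀ (S : Scheme.{u}) [IsIntegral S] [IsNoetherian S], Scheme.IsRegular S →
      Scheme.IsExcellent S → topologicalKrullDim S = 3 → ∀ (I : S.IdealSheafData), I ≠ ⊥ →
      ∀ (X : Scheme.{u}) (ρ : X ⟶ S) [IsIntegral X] [IsNoetherian X],
        IsRegularCentreBlowupSeq ρ I → ∀ (J : X.IdealSheafData) (μ : ℕ), 1 ≤ μ →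
          (∀ x ∈ J.support, 1 < Order.coheight x) → (∀ x, idealOrder J x ≤ μ) →
          (∃ x, idealOrder J x = μ) →
          ∃ (X' : Scheme.{u}) (π : X' ⟶ X) (J' : X'.IdealSheafData),
            IsPermissibleSeq π J μ J' ∧ ∀ x, idealOrder J' x < μ) :
    CossartPiltant2019Principalization.{u} := by
  intro S _ _ hreg hexc hdim I hI
  exact exists_principalization_of_prop44 S hreg hexc I hI (h44 S hreg hexc hdim I hI)

end Literature.AlgebraicGeometry.Resolution

end
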